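import Summits.QuantumFields.YangMills.Theorems.BalabanUVNodesPortZDStepLaw
import Summits.QuantumFields.YangMills.Theorems.BalabanUVNodesPortZDTransportHomogeneity

/-!
# NODE O port, row PT-A′ helper lane (PTZ-1, gen 3): THE FIBRE LAW OF THE KERNEL TRANSFORM OF RECORD — the displayed interface `hμ` of `…PortZDStepLaw` INHABITED at
# `transportOfRecord`: the normalised measure `Z⁻¹ · I(A) · (h(V)·condLaw V)` satisfies `∫ f dμ = T(f·I(A))(V) ∕ T(I(A))(V)` for EVERY `f` (χ ≥ 0, `I(A)` measurable)

[Balaban1987RG1] = [I] (CMP 109, 1987): (0.13) p. 254, (0.19) p. 255–256, (2.10)–(2.13) pp. 267–268 («the quadratic form defines also a Gaussian measure», the fluctuation measure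
`dμ_{C^{(k)}} χ_k exp[…]` normalised «at U_{k+1} = 1»); [Balaban1988Convergent] = [III] (CMP 119, 1988): (3.1) p. 264.

Seat `ymgap-nodeO-port-PTZ-1` g3 (prover, HELPER MODE; `--supports stmt-QuantumFields-27930 --as helper`).  Generic layer (no token of the χ-cone of record); CRIT-1 Q-5 (β).
WHAT IS PROVED (0 sorry; no `def` ∕ `instance` ∕ `notation`): ★ `stepLaw_transportOfRecord` — for `0 ≤ χ` and `I(A) := χ·e^{−GF∕g² + A}` measurable, the measure
`μ := ENNReal.ofReal((T(I(A))(V))⁻¹ · h(V)) • (avgKernel V).withDensity (ENNReal.ofReal ∘ I(A))` (`h` = the marginal density `avgDensity`, `avgKernel V` = `condLaw` of `dU` along the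
averaging of record) satisfies the fibre-law identity `∀ f, ∫ f dμ = T(f·I(A))(V) ∕ T(I(A))(V)` with `T := transportOfRecord F N K k` — consistently on the junk branch `T(I(A))(V) = 0` as
well (both sides `0`); `isProbabilityMeasure_stepLaw_transportOfRecord` — it is a probability law when `T(I(A))(V) ≠ 0`; ★ `moment_transportOfRecord_eq_integral_exp` — the kernel
transform's moment functional `T(I(A + F))(V) ∕ T(I(A))(V)` IS `∫ e^{F} dμ`.  So every row of `…PortZDStepLaw` applies to the kernel transform with THIS `μ` (and to `TcanOfRecord` wherever
it reads the kernel transform — `regSetOfRecord`, node00's located (F1)–(F3); not asserted here).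

HONEST FRAMING.  Measure bookkeeping (`integral_smul_measure`, `integral_withDensity_eq_integral_toReal_smul₀`); NOTHING of Bałaban's estimates asserted, ported or discharged; no named fact
introduced; 26648 ∕ 27930⁸ SIGNED·OPEN (content-gated), 27931 OPEN (RC-3), 27932 CLOSED; K0⁷ ∕ K-Ax OPEN; counts unmoved; finite 𝕋⁴ at fixed ε — NOT continuum ∕ OS ∕ Clay; the Yang–Mills
mass gap is NOT proved by any of this.  No `sorry`, no `instance`, no `notation`, no `def`.
-/

noncomputable section

open MeasureTheory
open scoped ENNReal

namespace Summit.QuantumFields.YangMills.Theorems.PortZD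

open Literature.MathematicalPhysics.QuantumFieldTheory.Balaban1983to89
open Literature.MathematicalPhysics.QuantumFieldTheory.Balaban1983to89.Node00
open T4Continuum (T4Family)
open B12Eq019ActionBody (integrand integrand_apply)

variable (F : T4Family) (N : ℕ) [NeZero N]

/-- Unfolding of the kernel transform of record at a point: `(Tρ)(V) = h(V) · ∫ ρ d(avgKernel V)` (`rfl`). [cite: Balaban1988Convergent, (3.1) p.264 (bookkeeping)] -/
theorem transportOfRecord_apply_eq {K k : ℕ} (ρ : Density (F.P K) k (SU N)) (V : GaugeField (F.P K) (k + 1) (SU N)) :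
    transportOfRecord F N K k ρ V =
      (T4AveragingDisintegration.avgDensity (avOfRecord F N K k).avg V : ℝ) * ∫ U, ρ U ∂(T4AveragingDisintegration.avgKernel (avOfRecord F N K k).avg V) := rfl

/-- `I(A) = χ·e^{…} ≥ 0` pointwise for `χ ≥ 0`. [cite: Balaban1987RG1, (0.19) p.255 (bookkeeping)] -/
theorem integrand_nonneg_of_chi_nonneg {P : Params} {G : Type*} {k : ℕ} {χ : Density P k G} (hχ : ∀ U, 0 ≤ χ U) (GF : Density P k G) (gk : ℝ) (A : Density P k G)
    (U : GaugeField P k G) : 0 ≤ integrand χ GF gk A U := by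
  rw [integrand_apply]; exact mul_nonneg (hχ U) (Real.exp_pos _).le

/-- The kernel transform of a non-negative density is non-negative (`transportOfRecord_nonneg` by name). [cite: Balaban1988Convergent, (3.1) p.264 (bookkeeping)] -/
theorem transportOfRecord_integrand_nonneg {K k : ℕ} {χ : Density (F.P K) k (SU N)} (hχ : ∀ U, 0 ≤ χ U) (GF : Density (F.P K) k (SU N)) (gk : ℝ)
    (A : Density (F.P K) k (SU N)) (V : GaugeField (F.P K) (k + 1) (SU N)) : 0 ≤ transportOfRecord F N K k (integrand χ GF gk A) V :=
  transportOfRecord_nonneg F N K k _ (integrand_nonneg_of_chi_nonneg hχ GF gk A) V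

/-- ★ **THE FIBRE LAW OF THE KERNEL TRANSFORM OF RECORD**: with `T := transportOfRecord F N K k`, `0 ≤ χ`, `I(A)` measurable, the normalised measure
`μ := ofReal((T(I(A))(V))⁻¹ · h(V)) • (avgKernel V).withDensity (ofReal ∘ I(A))` satisfies `∫ f dμ = T(f·I(A))(V) ∕ T(I(A))(V)` for EVERY `f` — the displayed interface `hμ` of
`…PortZDStepLaw`, inhabited. [cite: Balaban1987RG1, (0.13) p.254, (2.10)–(2.13) pp.267–268; Balaban1988Convergent, (3.1) p.264] -/
theorem stepLaw_transportOfRecord {K k : ℕ} {χ : Density (F.P K) k (SU N)} (hχ : ∀ U, 0 ≤ χ U) (GF : Density (F.P K) k (SU N)) (gk : ℝ)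
    (A : Density (F.P K) k (SU N)) (hm : Measurable (integrand χ GF gk A)) (V : GaugeField (F.P K) (k + 1) (SU N)) :
    ∀ f : Density (F.P K) k (SU N),
      ∫ U, f U ∂((ENNReal.ofReal ((transportOfRecord F N K k (integrand χ GF gk A) V)⁻¹ *
            (T4AveragingDisintegration.avgDensity (avOfRecord F N K k).avg V : ℝ))) •
          (T4AveragingDisintegration.avgKernel (avOfRecord F N K k).avg V).withDensity (fun U => ENNReal.ofReal (integrand χ GF gk A U))) =
        transportOfRecord F N K k (fun U => f U * integrand χ GF gk A U) V / transportOfRecord F N K k (integrand χ GF gk A) V := by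
  intro f
  set Z := transportOfRecord F N K k (integrand χ GF gk A) V with hZ
  set d : ℝ := (T4AveragingDisintegration.avgDensity (avOfRecord F N K k).avg V : ℝ) with hd
  have hd0 : 0 ≤ d := NNReal.coe_nonneg _
  have hZ0 : 0 ≤ Z := transportOfRecord_integrand_nonneg F N hχ GF gk A V
  have hc0 : 0 ≤ Z⁻¹ * d := mul_nonneg (inv_nonneg.2 hZ0) hd0
  rw [integral_smul_measure, ENNReal.toReal_ofReal hc0,
    integral_withDensity_eq_integral_toReal_smul₀ hm.ennreal_ofReal.aemeasurable (Filter.Eventually.of_forall fun _ => ENNReal.ofReal_lt_top)]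
  have hin : ∫ U, (ENNReal.ofReal (integrand χ GF gk A U)).toReal • f U ∂(T4AveragingDisintegration.avgKernel (avOfRecord F N K k).avg V) =
      ∫ U, f U * integrand χ GF gk A U ∂(T4AveragingDisintegration.avgKernel (avOfRecord F N K k).avg V) := by
    refine integral_congr_ae (Filter.Eventually.of_forall fun U => ?_)
    show (ENNReal.ofReal (integrand χ GF gk A U)).toReal • f U = f U * integrand χ GF gk A U
    rw [ENNReal.toReal_ofReal (integrand_nonneg_of_chi_nonneg hχ GF gk A U), smul_eq_mul, mul_comm]
  rw [hin, smul_eq_mul, transportOfRecord_apply_eq, ← hd]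
  ring

/-- … a PROBABILITY law as soon as `T(I(A))(V) ≠ 0` (`…PortZDStepLaw.isProbabilityMeasure_of_stepLaw`). [cite: Balaban1987RG1, (0.19) p.255–256 (bookkeeping)] -/
theorem isProbabilityMeasure_stepLaw_transportOfRecord {K k : ℕ} {χ : Density (F.P K) k (SU N)} (hχ : ∀ U, 0 ≤ χ U) (GF : Density (F.P K) k (SU N))
    (gk : ℝ) (A : Density (F.P K) k (SU N)) (hm : Measurable (integrand χ GF gk A)) (V : GaugeField (F.P K) (k + 1) (SU N))
    (hZ : transportOfRecord F N K k (integrand χ GF gk A) V ≠ 0) :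
    IsProbabilityMeasure ((ENNReal.ofReal ((transportOfRecord F N K k (integrand χ GF gk A) V)⁻¹ *
            (T4AveragingDisintegration.avgDensity (avOfRecord F N K k).avg V : ℝ))) •
          (T4AveragingDisintegration.avgKernel (avOfRecord F N K k).avg V).withDensity (fun U => ENNReal.ofReal (integrand χ GF gk A U))) :=
  isProbabilityMeasure_of_stepLaw (T := transportOfRecord F N K k) (stepLaw_transportOfRecord F N hχ GF gk A hm V) hZ

/-- ★ **THE KERNEL TRANSFORM'S MOMENT FUNCTIONAL IS AN EXPONENTIAL MOMENT**: `T(I(A + F))(V) ∕ T(I(A))(V) = ∫ e^{F} dμ` for the fibre law `μ` above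
(`…PortZDStepLaw.moment_eq_integral_exp_of_stepLaw`). [cite: Balaban1987RG1, (2.12)–(2.13) p.268 (bookkeeping)] -/
theorem moment_transportOfRecord_eq_integral_exp {K k : ℕ} {χ : Density (F.P K) k (SU N)} (hχ : ∀ U, 0 ≤ χ U) (GF : Density (F.P K) k (SU N))
    (gk : ℝ) (A : Density (F.P K) k (SU N)) (hm : Measurable (integrand χ GF gk A)) (V : GaugeField (F.P K) (k + 1) (SU N)) (F' : Density (F.P K) k (SU N)) :
    transportOfRecord F N K k (integrand χ GF gk (A + F')) V / transportOfRecord F N K k (integrand χ GF gk A) V =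
      ∫ U, Real.exp (F' U) ∂((ENNReal.ofReal ((transportOfRecord F N K k (integrand χ GF gk A) V)⁻¹ *
            (T4AveragingDisintegration.avgDensity (avOfRecord F N K k).avg V : ℝ))) •
          (T4AveragingDisintegration.avgKernel (avOfRecord F N K k).avg V).withDensity (fun U => ENNReal.ofReal (integrand χ GF gk A U))) :=
  moment_eq_integral_exp_of_stepLaw (T := transportOfRecord F N K k) (stepLaw_transportOfRecord F N hχ GF gk A hm V) F'

end Summit.QuantumFields.YangMills.Theorems.PortZD

end
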